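import Summits.Ventures.Crystal3D.Theorems.StickyWulffConstantStackingLiminfSliceMinkowski
import Summits.Ventures.Crystal3D.Theorems.StickyWulffConstantStackingLiminfSliceInner
import Summits.Ventures.Crystal3D.Theorems.StickyWulffConstantStackingLiminfSliceArea
import HarnessLib

/-!
# The sections of the stacking Wulff bodies `W_f` are EXACTLY the slice hexagons (crux
# `StackingLiminf`, stmt-Ventures-19145, line `LayerChain`, Step 2)

Route `StickyWulffConstant` of the venture `Summits/Ventures/Crystal3D` (cell `crystal3d-full`).
Combining the OUTER tent-window bounds for every `f ∈ [0,1]` (`…SliceMinkowski.lean`,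
`stackSlice_subset_tentWindow_*`) with the INNER windows of `…SliceInner.lean`
(`tentWindow_subset_stackSlice_*`, crystal3d-full eng) we get SET EQUALITIES: in each chamber the
section `stackSlice f (√(2/3)·Z)` of `W_f` IS the tent window (= the hexagon `α_f Δ + β_f (−Δ)`), and
hence (`volume_tentWindow`, `…SliceArea.lean`) its EXACT AREA in closed form:
* `|Z| ≤ 1`:   `|S_f(Z)| = (√3/2)(27 − w²)`, `w = (1−2f)Z`;
* `1 ≤ Z ≤ 3`: `|S_f(Z)| = (√3/4)(k w² + 12w + 24)`, `w = 3 − Z`, `k = 1 + 2f(1−f)`;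
* `−3 ≤ Z ≤ −1`: the same with `w = 3 + Z`;
and `S_f(Z) = ∅` for `|Z| > 3` (`stackSlice_eq_empty`).  These are the inputs of the volume law
`|W_f| = 4√2(16 + f(1−f))` (separate file).  WHAT THIS IS NOT: anything about the chimera; rung F-C1
not moved.
-/

noncomputable section

namespace Summit.Ventures.Crystal3D.Theorems

open MeasureTheory Set
open Summit.Ventures.Crystal3D.LayerChain

/-- **Exact section, chamber `|Z| ≤ 1`.** -/
theorem stackSlice_eq_tentWindow_mid (f Z : ℝ) (hf0 : 0 ≤ f) (hf1 : f ≤ 1) (hZ1 : -1 ≤ Z)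
    (hZ2 : Z ≤ 1) :
    stackSlice f (Real.sqrt (2 / 3) * Z) =
      {p : ℝ × ℝ | Real.sqrt 3 * (-3 / 2 + (1 - 2 * f) * Z / 6) ≤ p.2 ∧
        p.2 ≤ Real.sqrt 3 * (3 / 2 + (1 - 2 * f) * Z / 6) ∧
        |p.1| ≤ 3 - Real.sqrt 3 / 3 * |p.2 - Real.sqrt 3 * (-((1 - 2 * f) * Z / 3))|} :=
  Subset.antisymm (stackSlice_subset_tentWindow_mid f Z hf0 hf1)
    (tentWindow_subset_stackSlice_mid f Z hf0 hf1 hZ1 hZ2)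

/-- **Exact section, chamber `1 ≤ Z ≤ 3`.** -/
theorem stackSlice_eq_tentWindow_top (f Z : ℝ) (hf0 : 0 ≤ f) (hf1 : f ≤ 1) (hZ1 : 1 ≤ Z)
    (hZ2 : Z ≤ 3) :
    stackSlice f (Real.sqrt (2 / 3) * Z) =
      {p : ℝ × ℝ | Real.sqrt 3 * (-1 - (3 - Z) / 6 - f * (3 - Z) / 6) ≤ p.2 ∧
        p.2 ≤ Real.sqrt 3 * (1 + (3 - Z) / 3 - f * (3 - Z) / 6) ∧
        |p.1| ≤ (2 + (3 - Z) / 2) -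
          Real.sqrt 3 / 3 * |p.2 - Real.sqrt 3 * (-((3 - Z) / 6) + f * (3 - Z) / 3)|} :=
  Subset.antisymm (stackSlice_subset_tentWindow_top f Z hf0 hf1)
    (tentWindow_subset_stackSlice_top f Z hf0 hf1 hZ1 hZ2)

/-- **Exact section, chamber `−3 ≤ Z ≤ −1`.** -/
theorem stackSlice_eq_tentWindow_bot (f Z : ℝ) (hf0 : 0 ≤ f) (hf1 : f ≤ 1) (hZ1 : -3 ≤ Z)
    (hZ2 : Z ≤ -1) :
    stackSlice f (Real.sqrt (2 / 3) * Z) =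
      {p : ℝ × ℝ | Real.sqrt 3 * (-1 - (3 + Z) / 3 + f * (3 + Z) / 6) ≤ p.2 ∧
        p.2 ≤ Real.sqrt 3 * (1 + (3 + Z) / 6 + f * (3 + Z) / 6) ∧
        |p.1| ≤ (2 + (3 + Z) / 2) -
          Real.sqrt 3 / 3 * |p.2 - Real.sqrt 3 * ((3 + Z) / 6 - f * (3 + Z) / 3)|} :=
  Subset.antisymm (stackSlice_subset_tentWindow_bot f Z hf0 hf1)
    (tentWindow_subset_stackSlice_bot f Z hf0 hf1 hZ1 hZ2)

/-- **Exact area, chamber `|Z| ≤ 1`:** `|S_f(Z)| = (√3/2)(27 − ((1−2f)Z)²)`. -/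
theorem volume_stackSlice_mid (f Z : ℝ) (hf0 : 0 ≤ f) (hf1 : f ≤ 1) (hZ1 : -1 ≤ Z) (hZ2 : Z ≤ 1) :
    volume (stackSlice f (Real.sqrt (2 / 3) * Z)) =
      ENNReal.ofReal (Real.sqrt 3 / 2 * (27 - ((1 - 2 * f) * Z) ^ 2)) := by
  have h3 : Real.sqrt 3 * Real.sqrt 3 = 3 := Real.mul_self_sqrt (by norm_num)
  have hs : 0 < Real.sqrt 3 := Real.sqrt_pos.2 (by norm_num)
  have hw1 : -1 ≤ (1 - 2 * f) * Z := by nlinarith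
  have hw2 : (1 - 2 * f) * Z ≤ 1 := by nlinarith
  rw [stackSlice_eq_tentWindow_mid f Z hf0 hf1 hZ1 hZ2,
    volume_tentWindow _ _ _ _ _ (by nlinarith) (by nlinarith) (by positivity) (by nlinarith)
      (by nlinarith)]
  congr 1
  linear_combination (-(Real.sqrt 3 / 3) *
    ((3 / 2 - (1 - 2 * f) * Z / 2) ^ 2 + (3 / 2 + (1 - 2 * f) * Z / 2) ^ 2)) * h3

/-- **Exact area, chamber `1 ≤ Z ≤ 3`:** `|S_f(Z)| = (√3/4)((1 + 2f(1−f))w² + 12w + 24)`, `w = 3 − Z`. -/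
theorem volume_stackSlice_top (f Z : ℝ) (hf0 : 0 ≤ f) (hf1 : f ≤ 1) (hZ1 : 1 ≤ Z) (hZ2 : Z ≤ 3) :
    volume (stackSlice f (Real.sqrt (2 / 3) * Z)) =
      ENNReal.ofReal (Real.sqrt 3 / 4 *
        ((1 + 2 * f * (1 - f)) * (3 - Z) ^ 2 + 12 * (3 - Z) + 24)) := by
  have h3 : Real.sqrt 3 * Real.sqrt 3 = 3 := Real.mul_self_sqrt (by norm_num)
  have hs : 0 < Real.sqrt 3 := Real.sqrt_pos.2 (by norm_num)
  have hw : 0 ≤ 3 - Z := by linarith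
  have hfw : 0 ≤ f * (3 - Z) := mul_nonneg hf0 hw
  have hfw' : f * (3 - Z) ≤ 3 - Z := by nlinarith
  rw [stackSlice_eq_tentWindow_top f Z hf0 hf1 hZ1 hZ2,
    volume_tentWindow _ _ _ _ _ (by nlinarith) (by nlinarith) (by positivity) (by nlinarith)
      (by nlinarith)]
  congr 1
  linear_combination (-(Real.sqrt 3 / 3) *
    ((1 + f * (3 - Z) / 2) ^ 2 + (1 + (3 - Z) / 2 - f * (3 - Z) / 2) ^ 2)) * h3

/-- **Exact area, chamber `−3 ≤ Z ≤ −1`:** `|S_f(Z)| = (√3/4)((1 + 2f(1−f))w² + 12w + 24)`, `w = 3 + Z`. -/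
theorem volume_stackSlice_bot (f Z : ℝ) (hf0 : 0 ≤ f) (hf1 : f ≤ 1) (hZ1 : -3 ≤ Z)
    (hZ2 : Z ≤ -1) :
    volume (stackSlice f (Real.sqrt (2 / 3) * Z)) =
      ENNReal.ofReal (Real.sqrt 3 / 4 *
        ((1 + 2 * f * (1 - f)) * (3 + Z) ^ 2 + 12 * (3 + Z) + 24)) := by
  have h3 : Real.sqrt 3 * Real.sqrt 3 = 3 := Real.mul_self_sqrt (by norm_num)
  have hs : 0 < Real.sqrt 3 := Real.sqrt_pos.2 (by norm_num)
  have hw : 0 ≤ 3 + Z := by linarith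
  have hfw : 0 ≤ f * (3 + Z) := mul_nonneg hf0 hw
  have hfw' : f * (3 + Z) ≤ 3 + Z := by nlinarith
  rw [stackSlice_eq_tentWindow_bot f Z hf0 hf1 hZ1 hZ2,
    volume_tentWindow _ _ _ _ _ (by nlinarith) (by nlinarith) (by positivity) (by nlinarith)
      (by nlinarith)]
  congr 1
  linear_combination (-(Real.sqrt 3 / 3) *
    ((1 + (3 + Z) / 2 - f * (3 + Z) / 2) ^ 2 + (1 + f * (3 + Z) / 2) ^ 2)) * h3

/-- The section of `W_f` at height `√(2/3)·Z` has area zero for `|Z| > 3` (it is empty). -/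
theorem volume_stackSlice_eq_zero (f Z : ℝ) (hf0 : 0 ≤ f) (hf1 : f ≤ 1) (hZ : 3 < |Z|) :
    volume (stackSlice f (Real.sqrt (2 / 3) * Z)) = 0 := by
  rw [stackSlice_eq_empty f hf0 hf1 hZ, measure_empty]

end Summit.Ventures.Crystal3D.Theorems
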